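import Mathlib
import HarnessLib
import Summits.QuantumFields.YangMills.Theorems.LangevinControlUVFemtoCurvatureSkewnessCycleKernelBasics
import Summits.QuantumFields.YangMills.Theorems.LangevinControlUVFemtoCurvatureSkewnessGaussianSums

/-!
# Cycle heat kernel — Gaussian bounds on the Fourier side (helper for stub `stub_treeRatioFloor`)

For the cycle kernel `q(s,m) = (1/L)∑_k e^{-s ε(k)} cos(2πkm/L)` and the weight `w(s) = (1/L)∑_k ε(k) e^{-sε(k)}`
(carried as hypotheses `hε hq hw`, see `…CycleKernelBasics`), with absolute constants:
* `q(s,0) ≤ 2/L + (√π/4) s^{-1/2}` (`s > 0`) and `q(s,0) ≥ (e⁻¹/2π) s^{-1/2}` (`s ≥ 1`);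
* `w(s) ≤ (π²√(2π)/8) s^{-3/2}` (`s > 0`) and, for `1 ≤ s ≤ K L²`, `w(s) ≥ c(K) s^{-3/2}`;
* the diagonal/off-diagonal gap `q(s,0) - q(s,n) ≤ (π²√(2π)/16) n² s^{-3/2}` (no positivity needed).
All proofs: fold `k ↦ κ ∈ [0, L/2]`, use `16κ²/L² ≤ ε ≤ 4π²κ²/L²`, and compare with Gaussian sums/integrals.
The weight decay, written out, is the registered helper stub `CycleWeightDecay`.
-/

noncomputable section

namespace Summit.QuantumFields.YangMills.Theorems.FemtoCurvatureSkewness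

open Finset
open scoped BigOperators

namespace CycleKernel

variable {L : ℕ} [NeZero L] {ε : ZMod L → ℝ} {q : ℝ → ZMod L → ℝ} {w : ℝ → ℝ}

omit [NeZero L] in
/-- The Gaussian parameter `α = 16 s/L²`: `√(c/α) = √c · L/(4√s)`. -/
theorem sqrt_div_alpha {c s : ℝ} (hc : 0 ≤ c) (hs : 0 < s) (hL : (0 : ℝ) < L) :
    Real.sqrt (c / (16 * s / (L : ℝ) ^ 2)) = Real.sqrt c * L / (4 * Real.sqrt s) := by
  rw [Real.sqrt_div hc, sqrt_sixteen_mul_div_sq hs.le hL]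
  have : 0 < Real.sqrt s := Real.sqrt_pos.mpr hs
  field_simp

/-- **Diagonal upper bound** `q(s,0) ≤ 2/L + (√π/4)/√s` for `s > 0`. -/
theorem q_zero_le (hε : ∀ k, ε k = 2 - 2 * Real.cos (2 * Real.pi * (k.val : ℝ) / L))
    (hq : ∀ s m, q s m = (∑ k : ZMod L, Real.exp (-(s * ε k)) *
      Real.cos (2 * Real.pi * (k.val : ℝ) * (m.val : ℝ) / L)) / L) {s : ℝ} (hs : 0 < s) :
    q s 0 ≤ 2 / L + Real.sqrt Real.pi / 4 / Real.sqrt s := by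
  have hL : (0 : ℝ) < L := by exact_mod_cast NeZero.pos L
  have hα : 0 < 16 * s / (L : ℝ) ^ 2 := by positivity
  rw [q_zero hq, div_le_iff₀ hL]
  calc ∑ k : ZMod L, Real.exp (-(s * ε k))
      ≤ ∑ k : ZMod L, Real.exp (-(16 * s / (L : ℝ) ^ 2 * (k.valMinAbs.natAbs : ℝ) ^ 2)) :=
        Finset.sum_le_sum fun k _ => by rw [hε]; exact exp_eps_le k hs.le
    _ ≤ 2 * ∑ j ∈ range (L / 2 + 1), Real.exp (-(16 * s / (L : ℝ) ^ 2 * (j : ℝ) ^ 2)) :=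
        sum_fold_le (fun j => Real.exp (-(16 * s / (L : ℝ) ^ 2 * (j : ℝ) ^ 2))) fun j => Real.exp_nonneg _
    _ ≤ 2 * (1 + Real.sqrt (Real.pi / (16 * s / (L : ℝ) ^ 2)) / 2) := by
        gcongr; exact sum_range_succ_exp_le hα _
    _ = (2 / L + Real.sqrt Real.pi / 4 / Real.sqrt s) * L := by
        rw [sqrt_div_alpha Real.pi_pos.le hs hL]
        have : 0 < Real.sqrt s := Real.sqrt_pos.mpr hs
        field_simp

/-- **Diagonal lower bound** `e⁻¹/(2π√s) ≤ q(s,0)` for `s ≥ 1`: the modes `0 ≤ k ≤ L/(2π√s)` each contribute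
at least `e⁻¹/L`. -/
theorem le_q_zero (hε : ∀ k, ε k = 2 - 2 * Real.cos (2 * Real.pi * (k.val : ℝ) / L))
    (hq : ∀ s m, q s m = (∑ k : ZMod L, Real.exp (-(s * ε k)) *
      Real.cos (2 * Real.pi * (k.val : ℝ) * (m.val : ℝ) / L)) / L) {s : ℝ} (hs : 1 ≤ s) :
    Real.exp (-1) / (2 * Real.pi * Real.sqrt s) ≤ q s 0 := by
  have hL : (0 : ℝ) < L := by exact_mod_cast NeZero.pos L
  have hs0 : 0 < s := by linarith
  have hss : 1 ≤ Real.sqrt s := by rw [← Real.sqrt_one]; exact Real.sqrt_le_sqrt hs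
  have hsp : 0 < Real.sqrt s := by linarith
  set x : ℝ := L / (2 * Real.pi * Real.sqrt s) with hx
  have hx0 : 0 ≤ x := by rw [hx]; positivity
  set m : ℕ := ⌊x⌋₊ with hm
  have hmx : (m : ℝ) ≤ x := Nat.floor_le hx0
  have hxm : x < (m : ℝ) + 1 := Nat.lt_floor_add_one x
  -- `m < L` since `x ≤ L/(2π) < L`
  have hxL : x < L := by
    rw [hx, div_lt_iff₀ (by positivity)]
    have : (1 : ℝ) < 2 * Real.pi * Real.sqrt s := by nlinarith [Real.pi_gt_three]
    nlinarith
  have hmL : m < L := by exact_mod_cast (lt_of_le_of_lt hmx hxL)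
  -- every mode `j ≤ m` has `s ε(j) ≤ 1`
  have hterm : ∀ j ∈ range (m + 1), Real.exp (-1) ≤ Real.exp (-(s * ε ((j : ℕ) : ZMod L))) := by
    intro j hj
    have hjm : (j : ℝ) ≤ m := by exact_mod_cast Nat.lt_succ_iff.mp (mem_range.mp hj)
    have hjx : (j : ℝ) ≤ x := hjm.trans hmx
    rw [Real.exp_le_exp, neg_le_neg_iff, hε]
    have h1 := eps_le_sq ((j : ℕ) : ZMod L)
    have hκ : (((j : ℕ) : ZMod L).valMinAbs.natAbs : ℝ) ≤ j := by
      rw [ZMod.valMinAbs_natAbs_eq_min, ZMod.val_cast_of_lt (by have := mem_range.mp hj; omega)]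
      exact_mod_cast min_le_left _ _
    -- `s · 4π² j²/L² ≤ 1` because `j ≤ x = L/(2π√s)`
    have h2 : s * (4 * Real.pi ^ 2 * (j : ℝ) ^ 2 / (L : ℝ) ^ 2) ≤ 1 := by
      have h3 : 2 * Real.pi * Real.sqrt s * (j : ℝ) ≤ L := by
        have := mul_le_mul_of_nonneg_left hjx (by positivity : (0 : ℝ) ≤ 2 * Real.pi * Real.sqrt s)
        rwa [hx, mul_div_cancel₀ _ (by positivity : (2 * Real.pi * Real.sqrt s) ≠ 0)] at this
      have h4 : 0 ≤ 2 * Real.pi * Real.sqrt s * (j : ℝ) := by positivity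
      have h5 : (2 * Real.pi * Real.sqrt s * (j : ℝ)) ^ 2 ≤ (L : ℝ) ^ 2 := pow_le_pow_left₀ h4 h3 2
      have h6 : s * (4 * Real.pi ^ 2 * (j : ℝ) ^ 2 / (L : ℝ) ^ 2) =
          (2 * Real.pi * Real.sqrt s * (j : ℝ)) ^ 2 / (L : ℝ) ^ 2 := by
        rw [mul_pow, mul_pow, mul_pow, Real.sq_sqrt hs0.le]; ring
      rw [h6, div_le_one (by positivity)]
      exact h5
    have h6 : (((j : ℕ) : ZMod L).valMinAbs.natAbs : ℝ) ^ 2 ≤ (j : ℝ) ^ 2 :=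
      pow_le_pow_left₀ (Nat.cast_nonneg _) hκ 2
    calc s * (2 - 2 * Real.cos (2 * Real.pi * ((((j : ℕ) : ZMod L)).val : ℝ) / L))
        ≤ s * (4 * Real.pi ^ 2 * (((j : ℕ) : ZMod L).valMinAbs.natAbs : ℝ) ^ 2 / (L : ℝ) ^ 2) := by gcongr
      _ ≤ s * (4 * Real.pi ^ 2 * (j : ℝ) ^ 2 / (L : ℝ) ^ 2) := by gcongr
      _ ≤ 1 := h2
  calc Real.exp (-1) / (2 * Real.pi * Real.sqrt s) = x * Real.exp (-1) / L := by
        rw [hx]; field_simp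
    _ ≤ ((m : ℝ) + 1) * Real.exp (-1) / L := by gcongr
    _ = (∑ j ∈ range (m + 1), Real.exp (-1)) / L := by simp
    _ ≤ (∑ j ∈ range (m + 1), Real.exp (-(s * ε ((j : ℕ) : ZMod L)))) / L :=
        div_le_div_of_nonneg_right (Finset.sum_le_sum hterm) hL.le
    _ ≤ (∑ k : ZMod L, Real.exp (-(s * ε k))) / L := by
        gcongr
        exact sum_range_cast_le (fun k => Real.exp (-(s * ε k))) (fun _ => Real.exp_nonneg _) hmL
    _ = q s 0 := (q_zero hq s).symm

/-- **Weight upper bound** `w(s) ≤ (π²√(2π)/8) s^{-3/2}` for `s > 0`. -/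
theorem w_le (hε : ∀ k, ε k = 2 - 2 * Real.cos (2 * Real.pi * (k.val : ℝ) / L))
    (hw : ∀ s, w s = (∑ k : ZMod L, ε k * Real.exp (-(s * ε k))) / L) {s : ℝ} (hs : 0 < s) :
    w s ≤ Real.pi ^ 2 * Real.sqrt (2 * Real.pi) / 8 / (s * Real.sqrt s) := by
  have hL : (0 : ℝ) < L := by exact_mod_cast NeZero.pos L
  have hα : 0 < 16 * s / (L : ℝ) ^ 2 := by positivity
  have hsp : 0 < Real.sqrt s := Real.sqrt_pos.mpr hs
  rw [hw, div_le_iff₀ hL]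
  calc ∑ k : ZMod L, ε k * Real.exp (-(s * ε k))
      ≤ ∑ k : ZMod L, 4 * Real.pi ^ 2 / (L : ℝ) ^ 2 * ((k.valMinAbs.natAbs : ℝ) ^ 2 *
          Real.exp (-(16 * s / (L : ℝ) ^ 2 * (k.valMinAbs.natAbs : ℝ) ^ 2))) := by
        refine Finset.sum_le_sum fun k _ => ?_
        have h1 : ε k ≤ 4 * Real.pi ^ 2 * (k.valMinAbs.natAbs : ℝ) ^ 2 / (L : ℝ) ^ 2 := by
          rw [hε]; exact eps_le_sq k
        have h2 : Real.exp (-(s * ε k)) ≤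
            Real.exp (-(16 * s / (L : ℝ) ^ 2 * (k.valMinAbs.natAbs : ℝ) ^ 2)) := by
          rw [hε]; exact exp_eps_le k hs.le
        have h3 : 0 ≤ ε k := by rw [hε]; exact eps_nonneg k
        calc ε k * Real.exp (-(s * ε k))
            ≤ (4 * Real.pi ^ 2 * (k.valMinAbs.natAbs : ℝ) ^ 2 / (L : ℝ) ^ 2) *
                Real.exp (-(16 * s / (L : ℝ) ^ 2 * (k.valMinAbs.natAbs : ℝ) ^ 2)) :=
              mul_le_mul h1 h2 (Real.exp_nonneg _) (by positivity)
          _ = _ := by ring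
    _ = 4 * Real.pi ^ 2 / (L : ℝ) ^ 2 * ∑ k : ZMod L, ((k.valMinAbs.natAbs : ℝ) ^ 2 *
          Real.exp (-(16 * s / (L : ℝ) ^ 2 * (k.valMinAbs.natAbs : ℝ) ^ 2))) := by rw [Finset.mul_sum]
    _ ≤ 4 * Real.pi ^ 2 / (L : ℝ) ^ 2 * (2 * ∑ j ∈ range (L / 2 + 1), ((j : ℝ) ^ 2 *
          Real.exp (-(16 * s / (L : ℝ) ^ 2 * (j : ℝ) ^ 2)))) := by
        gcongr
        exact sum_fold_le (fun j => (j : ℝ) ^ 2 * Real.exp (-(16 * s / (L : ℝ) ^ 2 * (j : ℝ) ^ 2)))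
          fun j => by positivity
    _ ≤ 4 * Real.pi ^ 2 / (L : ℝ) ^ 2 * (2 * (Real.sqrt (2 * Real.pi / (16 * s / (L : ℝ) ^ 2)) /
          (16 * s / (L : ℝ) ^ 2))) := by
        gcongr
        exact sum_range_succ_sq_mul_exp_le hα _
    _ = Real.pi ^ 2 * Real.sqrt (2 * Real.pi) / 8 / (s * Real.sqrt s) * L := by
        rw [sqrt_div_alpha (by positivity) hs hL]
        field_simp
        ring

/-- **Gap bound** `q(s,0) - q(s,n) ≤ (π²√(2π)/16) n² s^{-3/2}` for `s > 0`, `n < L`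
(`1 - cos y ≤ y²/2`; no positivity of the kernel is needed). -/
theorem q_zero_sub_q_le (hε : ∀ k, ε k = 2 - 2 * Real.cos (2 * Real.pi * (k.val : ℝ) / L))
    (hq : ∀ s m, q s m = (∑ k : ZMod L, Real.exp (-(s * ε k)) *
      Real.cos (2 * Real.pi * (k.val : ℝ) * (m.val : ℝ) / L)) / L) {s : ℝ} (hs : 0 < s) {n : ℕ} (hn : n < L) :
    q s 0 - q s (n : ZMod L) ≤ Real.pi ^ 2 * Real.sqrt (2 * Real.pi) / 16 * (n : ℝ) ^ 2 / (s * Real.sqrt s) := by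
  have hL : (0 : ℝ) < L := by exact_mod_cast NeZero.pos L
  have hα : 0 < 16 * s / (L : ℝ) ^ 2 := by positivity
  have hsp : 0 < Real.sqrt s := Real.sqrt_pos.mpr hs
  have hsub : q s 0 - q s (n : ZMod L) =
      (∑ k : ZMod L, Real.exp (-(s * ε k)) * (1 - Real.cos (2 * Real.pi * (k.val : ℝ) * (n : ℤ) / L))) / L := by
    rw [q_zero hq, hq, ← sub_div, ← Finset.sum_sub_distrib]
    congr 1
    refine Finset.sum_congr rfl fun k _ => ?_
    rw [ZMod.val_cast_of_lt hn]
    push_cast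
    ring
  rw [hsub, div_le_iff₀ hL]
  calc ∑ k : ZMod L, Real.exp (-(s * ε k)) * (1 - Real.cos (2 * Real.pi * (k.val : ℝ) * (n : ℤ) / L))
      ≤ ∑ k : ZMod L, 2 * Real.pi ^ 2 * (n : ℝ) ^ 2 / (L : ℝ) ^ 2 * ((k.valMinAbs.natAbs : ℝ) ^ 2 *
          Real.exp (-(16 * s / (L : ℝ) ^ 2 * (k.valMinAbs.natAbs : ℝ) ^ 2))) := by
        refine Finset.sum_le_sum fun k _ => ?_
        have h1 := one_sub_cos_le k (n : ℤ)
        have h2 : Real.exp (-(s * ε k)) ≤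
            Real.exp (-(16 * s / (L : ℝ) ^ 2 * (k.valMinAbs.natAbs : ℝ) ^ 2)) := by
          rw [hε]; exact exp_eps_le k hs.le
        have h3 : 0 ≤ 1 - Real.cos (2 * Real.pi * (k.val : ℝ) * (n : ℤ) / L) := by
          have := Real.cos_le_one (2 * Real.pi * (k.val : ℝ) * (n : ℤ) / L); linarith
        calc Real.exp (-(s * ε k)) * (1 - Real.cos (2 * Real.pi * (k.val : ℝ) * (n : ℤ) / L))
            ≤ Real.exp (-(16 * s / (L : ℝ) ^ 2 * (k.valMinAbs.natAbs : ℝ) ^ 2)) *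
                (2 * Real.pi ^ 2 * (k.valMinAbs.natAbs : ℝ) ^ 2 * ((n : ℤ) : ℝ) ^ 2 / (L : ℝ) ^ 2) :=
              mul_le_mul h2 h1 h3 (Real.exp_nonneg _)
          _ = _ := by push_cast; ring
    _ = 2 * Real.pi ^ 2 * (n : ℝ) ^ 2 / (L : ℝ) ^ 2 * ∑ k : ZMod L, ((k.valMinAbs.natAbs : ℝ) ^ 2 *
          Real.exp (-(16 * s / (L : ℝ) ^ 2 * (k.valMinAbs.natAbs : ℝ) ^ 2))) := by rw [Finset.mul_sum]
    _ ≤ 2 * Real.pi ^ 2 * (n : ℝ) ^ 2 / (L : ℝ) ^ 2 * (2 * ∑ j ∈ range (L / 2 + 1), ((j : ℝ) ^ 2 *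
          Real.exp (-(16 * s / (L : ℝ) ^ 2 * (j : ℝ) ^ 2)))) := by
        gcongr
        exact sum_fold_le (fun j => (j : ℝ) ^ 2 * Real.exp (-(16 * s / (L : ℝ) ^ 2 * (j : ℝ) ^ 2)))
          fun j => by positivity
    _ ≤ 2 * Real.pi ^ 2 * (n : ℝ) ^ 2 / (L : ℝ) ^ 2 * (2 * (Real.sqrt (2 * Real.pi / (16 * s / (L : ℝ) ^ 2)) /
          (16 * s / (L : ℝ) ^ 2))) := by
        gcongr
        exact sum_range_succ_sq_mul_exp_le hα _
    _ = Real.pi ^ 2 * Real.sqrt (2 * Real.pi) / 16 * (n : ℝ) ^ 2 / (s * Real.sqrt s) * L := by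
        rw [sqrt_div_alpha (by positivity) hs hL]
        field_simp
        ring

/-- **First-mode lower bound on the weight**: `(16/L³) e^{-4π²K} ≤ w(s)` for `0 ≤ s ≤ K L²` (`L ≥ 2`): keep the
single mode `k = 1`, whose dispersion lies in `[16/L², 4π²/L²]`. -/
theorem first_mode_le_w (hε : ∀ k, ε k = 2 - 2 * Real.cos (2 * Real.pi * (k.val : ℝ) / L))
    (hw : ∀ s, w s = (∑ k : ZMod L, ε k * Real.exp (-(s * ε k))) / L) (hL2 : 2 ≤ L) {K s : ℝ}
    (hs : 0 ≤ s) (hsK : s ≤ K * (L : ℝ) ^ 2) :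
    16 / (L : ℝ) ^ 3 * Real.exp (-(4 * Real.pi ^ 2 * K)) ≤ w s := by
  have hL : (0 : ℝ) < L := by exact_mod_cast NeZero.pos L
  have hκ : ((1 : ZMod L).valMinAbs.natAbs) = 1 := by
    have h := fold_natCast (L := L) (n := 1) (by omega)
    rwa [Nat.cast_one] at h
  have h1 : 16 / (L : ℝ) ^ 2 ≤ ε 1 := by
    have h := sq_le_eps (1 : ZMod L)
    rw [hκ, Nat.cast_one, one_pow, mul_one] at h
    rwa [hε]
  have h2 : ε 1 ≤ 4 * Real.pi ^ 2 / (L : ℝ) ^ 2 := by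
    have h := eps_le_sq (1 : ZMod L)
    rw [hκ, Nat.cast_one, one_pow, mul_one] at h
    rwa [hε]
  have h0 : 0 ≤ ε 1 := by rw [hε]; exact eps_nonneg 1
  have h3 : Real.exp (-(4 * Real.pi ^ 2 * K)) ≤ Real.exp (-(s * ε 1)) := by
    rw [Real.exp_le_exp, neg_le_neg_iff]
    calc s * ε 1 ≤ s * (4 * Real.pi ^ 2 / (L : ℝ) ^ 2) := mul_le_mul_of_nonneg_left h2 hs
      _ ≤ K * (L : ℝ) ^ 2 * (4 * Real.pi ^ 2 / (L : ℝ) ^ 2) := by gcongr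
      _ = 4 * Real.pi ^ 2 * K := by field_simp
  rw [hw, le_div_iff₀ hL]
  calc 16 / (L : ℝ) ^ 3 * Real.exp (-(4 * Real.pi ^ 2 * K)) * L
      = 16 / (L : ℝ) ^ 2 * Real.exp (-(4 * Real.pi ^ 2 * K)) := by field_simp
    _ ≤ ε 1 * Real.exp (-(s * ε 1)) := mul_le_mul h1 h3 (Real.exp_nonneg _) h0
    _ ≤ ∑ k : ZMod L, ε k * Real.exp (-(s * ε k)) :=
        Finset.single_le_sum (f := fun k => ε k * Real.exp (-(s * ε k)))
          (fun k _ => mul_nonneg (by rw [hε]; exact eps_nonneg k) (Real.exp_nonneg _)) (mem_univ _)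

/-- **Bulk lower bound on the weight**: for `s ≥ 1` and `2π√s ≤ L`, `w(s) ≥ (12 e π³)⁻¹ s^{-3/2}`: the modes
`1 ≤ k ≤ L/(2π√s)` each contribute at least `16k² e⁻¹/L³`. -/
theorem le_w_bulk (hε : ∀ k, ε k = 2 - 2 * Real.cos (2 * Real.pi * (k.val : ℝ) / L))
    (hw : ∀ s, w s = (∑ k : ZMod L, ε k * Real.exp (-(s * ε k))) / L) {s : ℝ} (hs : 1 ≤ s)
    (hLs : 2 * Real.pi * Real.sqrt s ≤ L) :
    1 / (12 * Real.exp 1 * Real.pi ^ 3) / (s * Real.sqrt s) ≤ w s := by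
  have hL : (0 : ℝ) < L := by exact_mod_cast NeZero.pos L
  have hs0 : 0 < s := by linarith
  have hss : 1 ≤ Real.sqrt s := by rw [← Real.sqrt_one]; exact Real.sqrt_le_sqrt hs
  have hsp : 0 < Real.sqrt s := by linarith
  set x : ℝ := L / (2 * Real.pi * Real.sqrt s) with hx
  have hx1 : 1 ≤ x := by rw [hx, le_div_iff₀ (by positivity)]; linarith
  obtain ⟨hm1, hxm2, hmx, hxm⟩ := floor_facts hx1
  set m : ℕ := ⌊x⌋₊ with hm
  have hxL2 : 2 * x ≤ L := by
    rw [hx]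
    have e : 2 * (L / (2 * Real.pi * Real.sqrt s)) = L / (Real.pi * Real.sqrt s) := by
      field_simp
    rw [e, div_le_iff₀ (by positivity)]
    have : (1 : ℝ) ≤ Real.pi * Real.sqrt s := by nlinarith [Real.pi_gt_three]
    nlinarith
  have hmL2 : m ≤ L / 2 := by
    rw [Nat.le_div_iff_mul_le two_pos]
    exact_mod_cast (show ((m : ℕ) : ℝ) * 2 ≤ L by linarith)
  have hmL : m < L := by have := NeZero.pos L; omega
  -- termwise: `16 j² e⁻¹/L² ≤ ε(j) e^{-s ε(j)}` for `j ≤ m`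
  have hterm : ∀ j ∈ range (m + 1), 16 * Real.exp (-1) / (L : ℝ) ^ 2 * ((j : ℕ) : ℝ) ^ 2 ≤
      ε ((j : ℕ) : ZMod L) * Real.exp (-(s * ε ((j : ℕ) : ZMod L))) := by
    intro j hj
    have hjm : j ≤ m := Nat.lt_succ_iff.mp (mem_range.mp hj)
    have hjx : (j : ℝ) ≤ x := le_trans (by exact_mod_cast hjm) hmx
    have hκ : ((j : ℕ) : ZMod L).valMinAbs.natAbs = j := fold_natCast (hjm.trans hmL2)
    have h1 : 16 * (j : ℝ) ^ 2 / (L : ℝ) ^ 2 ≤ ε ((j : ℕ) : ZMod L) := by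
      have h := sq_le_eps ((j : ℕ) : ZMod L)
      rw [hκ] at h
      rwa [hε]
    have h2 : ε ((j : ℕ) : ZMod L) ≤ 4 * Real.pi ^ 2 * (j : ℝ) ^ 2 / (L : ℝ) ^ 2 := by
      have h := eps_le_sq ((j : ℕ) : ZMod L)
      rw [hκ] at h
      rwa [hε]
    have h3 : Real.exp (-1) ≤ Real.exp (-(s * ε ((j : ℕ) : ZMod L))) := by
      rw [Real.exp_le_exp, neg_le_neg_iff]
      have h4 : 2 * Real.pi * Real.sqrt s * (j : ℝ) ≤ L := by
        have := mul_le_mul_of_nonneg_left hjx (by positivity : (0 : ℝ) ≤ 2 * Real.pi * Real.sqrt s)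
        rwa [hx, mul_div_cancel₀ _ (by positivity : (2 * Real.pi * Real.sqrt s) ≠ 0)] at this
      have h5 : (2 * Real.pi * Real.sqrt s * (j : ℝ)) ^ 2 ≤ (L : ℝ) ^ 2 :=
        pow_le_pow_left₀ (by positivity) h4 2
      have h6 : s * (4 * Real.pi ^ 2 * (j : ℝ) ^ 2 / (L : ℝ) ^ 2) =
          (2 * Real.pi * Real.sqrt s * (j : ℝ)) ^ 2 / (L : ℝ) ^ 2 := by
        rw [mul_pow, mul_pow, mul_pow, Real.sq_sqrt hs0.le]; ring
      calc s * ε ((j : ℕ) : ZMod L) ≤ s * (4 * Real.pi ^ 2 * (j : ℝ) ^ 2 / (L : ℝ) ^ 2) :=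
            mul_le_mul_of_nonneg_left h2 hs0.le
        _ ≤ 1 := by rw [h6, div_le_one (by positivity)]; exact h5
    calc 16 * Real.exp (-1) / (L : ℝ) ^ 2 * ((j : ℕ) : ℝ) ^ 2
        = (16 * (j : ℝ) ^ 2 / (L : ℝ) ^ 2) * Real.exp (-1) := by ring
      _ ≤ _ := mul_le_mul h1 h3 (Real.exp_nonneg _) (by rw [hε]; exact eps_nonneg _)
  -- sum the modes `j ≤ m` and use `∑ j² ≥ m³/3 ≥ x³/24`
  have hsq : (m : ℝ) ^ 3 / 3 ≤ ∑ j ∈ range (m + 1), ((j : ℕ) : ℝ) ^ 2 := by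
    rw [Finset.sum_range_succ']
    push_cast
    simpa using cube_div_three_le_sum_sq m
  have hx3 : x ^ 3 / 24 ≤ ∑ j ∈ range (m + 1), ((j : ℕ) : ℝ) ^ 2 := by
    refine le_trans ?_ hsq
    have : x ^ 3 ≤ (2 * (m : ℝ)) ^ 3 := pow_le_pow_left₀ (by linarith) (by linarith) 3
    nlinarith
  have hs3 : Real.sqrt s ^ 3 = s * Real.sqrt s := by rw [pow_succ, Real.sq_sqrt hs0.le]
  have ex3 : x ^ 3 = (L : ℝ) ^ 3 / (8 * Real.pi ^ 3 * (s * Real.sqrt s)) := by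
    rw [hx, div_pow, mul_pow, mul_pow, hs3]; ring
  rw [hw, le_div_iff₀ hL]
  calc 1 / (12 * Real.exp 1 * Real.pi ^ 3) / (s * Real.sqrt s) * L
      = 16 * Real.exp (-1) / (L : ℝ) ^ 2 * (x ^ 3 / 24) := by
        rw [ex3, Real.exp_neg]; field_simp; ring
    _ ≤ 16 * Real.exp (-1) / (L : ℝ) ^ 2 * ∑ j ∈ range (m + 1), ((j : ℕ) : ℝ) ^ 2 := by gcongr
    _ = ∑ j ∈ range (m + 1), 16 * Real.exp (-1) / (L : ℝ) ^ 2 * ((j : ℕ) : ℝ) ^ 2 := by rw [Finset.mul_sum]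
    _ ≤ ∑ j ∈ range (m + 1), ε ((j : ℕ) : ZMod L) * Real.exp (-(s * ε ((j : ℕ) : ZMod L))) :=
        Finset.sum_le_sum hterm
    _ ≤ ∑ k : ZMod L, ε k * Real.exp (-(s * ε k)) :=
        sum_range_cast_le (fun k => ε k * Real.exp (-(s * ε k)))
          (fun k => mul_nonneg (by rw [hε]; exact eps_nonneg k) (Real.exp_nonneg _)) hmL

/-- **Weight lower bound** on `1 ≤ s ≤ K L²` (`L ≥ 2`, `K > 0`): `c_w(K) s^{-3/2} ≤ w(s)` with
`c_w(K) = min((12eπ³)⁻¹, 2e^{-4π²K}/π³)` (bulk modes if `2π√s ≤ L`, else the first mode). -/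
theorem le_w (hε : ∀ k, ε k = 2 - 2 * Real.cos (2 * Real.pi * (k.val : ℝ) / L))
    (hw : ∀ s, w s = (∑ k : ZMod L, ε k * Real.exp (-(s * ε k))) / L) (hL2 : 2 ≤ L) {K s : ℝ}
    (hs : 1 ≤ s) (hsK : s ≤ K * (L : ℝ) ^ 2) :
    min (1 / (12 * Real.exp 1 * Real.pi ^ 3)) (2 * Real.exp (-(4 * Real.pi ^ 2 * K)) / Real.pi ^ 3) /
      (s * Real.sqrt s) ≤ w s := by
  have hL : (0 : ℝ) < L := by exact_mod_cast NeZero.pos L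
  have hs0 : 0 < s := by linarith
  have hsp : 0 < Real.sqrt s := Real.sqrt_pos.mpr hs0
  by_cases h : 2 * Real.pi * Real.sqrt s ≤ L
  · exact (div_le_div_of_nonneg_right (min_le_left _ _) (by positivity)).trans (le_w_bulk hε hw hs h)
  · have hlt : (L : ℝ) ≤ 2 * Real.pi * Real.sqrt s := le_of_lt (not_le.mp h)
    have hc : (L : ℝ) ^ 3 ≤ (2 * Real.pi * Real.sqrt s) ^ 3 := pow_le_pow_left₀ hL.le hlt 3
    have hs3 : Real.sqrt s ^ 3 = s * Real.sqrt s := by rw [pow_succ, Real.sq_sqrt hs0.le]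
    have e3 : (2 * Real.pi * Real.sqrt s) ^ 3 = 8 * Real.pi ^ 3 * (s * Real.sqrt s) := by
      rw [mul_pow, mul_pow, hs3]; ring
    rw [e3] at hc
    have key : 2 / Real.pi ^ 3 / (s * Real.sqrt s) ≤ 16 / (L : ℝ) ^ 3 := by
      rw [div_div, div_le_div_iff₀ (by positivity) (by positivity)]
      linarith
    calc min (1 / (12 * Real.exp 1 * Real.pi ^ 3)) (2 * Real.exp (-(4 * Real.pi ^ 2 * K)) / Real.pi ^ 3) /
          (s * Real.sqrt s)
        ≤ 2 * Real.exp (-(4 * Real.pi ^ 2 * K)) / Real.pi ^ 3 / (s * Real.sqrt s) :=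
          div_le_div_of_nonneg_right (min_le_right _ _) (by positivity)
      _ = 2 / Real.pi ^ 3 / (s * Real.sqrt s) * Real.exp (-(4 * Real.pi ^ 2 * K)) := by ring
      _ ≤ 16 / (L : ℝ) ^ 3 * Real.exp (-(4 * Real.pi ^ 2 * K)) := by gcongr
      _ ≤ w s := first_mode_le_w hε hw hL2 hs0.le hsK

end CycleKernel

/-- **Weight decay** (registered helper stub `CycleWeightDecay` of stmt-QuantumFields-9365):
`(1/L) ∑_k ε(k) e^{-s ε(k)} ≤ (π²√(2π)/8) s^{-3/2}` for `s > 0`. -/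
theorem CycleWeightDecay : ∀ (L : ℕ) [NeZero L] (s : ℝ), 0 < s →
    (∑ k : ZMod L, (2 - 2 * Real.cos (2 * Real.pi * (k.val : ℝ) / L)) *
      Real.exp (-(s * (2 - 2 * Real.cos (2 * Real.pi * (k.val : ℝ) / L))))) / L ≤
      Real.pi ^ 2 * Real.sqrt (2 * Real.pi) / 8 / (s * Real.sqrt s) := by
  intro L _ s hs
  exact CycleKernel.w_le (L := L) (ε := fun k => 2 - 2 * Real.cos (2 * Real.pi * (k.val : ℝ) / L))
    (w := fun s => (∑ k : ZMod L, (2 - 2 * Real.cos (2 * Real.pi * (k.val : ℝ) / L)) *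
      Real.exp (-(s * (2 - 2 * Real.cos (2 * Real.pi * (k.val : ℝ) / L))))) / L) (fun _ => rfl) (fun _ => rfl) hs

end Summit.QuantumFields.YangMills.Theorems.FemtoCurvatureSkewness

end
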